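import Mathlib
import HarnessLib
import Summits.HubbardSuperconductivity.HubbardSuperconductivity.Theorems.KLProgrammeDispersionFlowDefs

/-!
# Route `KLProgramme` (crux K3 `KLRegimeTwoPointLimit`, stmt-HubbardSuperconductivity-19937) — consequences of the
# KL-regime dispersion-flow invariant (I_h): FST II's geometric constants persist down the scales, with a
# `c`-INDEPENDENT lower curvature end

Cell `gate-hubbard-kl`, seat p2 (DECOMP v7 §2 C4a/C4b; vocabulary `KLProgrammeDispersionFlowDefs.lean`).  Benfatto–
Giuliani–Mastropietro 2006 Lemma 2.1 says the scale-`h` Fermi curves keep the convexity / transversality constants of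
the free one because the cumulative correction `ε_h - ε_0` is `C²`-SMALL ((2.41a), third line `C₂c₀²`).  In the
Kohn–Luttinger regime of K3 the second-order cumulative size is `A₂U²|h| = O(c)` — bounded, not small — and the
umklapp-corner logarithm (DECOMP App. C) is exactly of that size; what saves Lemma 2.1 is the SIGN (the tangential
floor of (I_h)).  This file PROVES that mechanism, abstractly and on the certified window:

* `GeomConstants.of_perturbation` (any real inner product space): `e` `C²` with FST II constants
  `(K, r₀, g₀, wmin)` (`FermiRG.GeomConstants`, typer file `FST2Hypotheses`, DEFINITION FROZEN) and a `C²` perturbation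
  `D` with `|D| ≤ a₀ < r₀`, `‖DD‖ ≤ a₁ < g₀` (`ρ := a₁/g₀`), all derivatives of order `≤ 2` bounded by `A`, and the
  ONE-SIDED bound `(t, D''t) ≥ -b|t|²` for `t` tangent to the level sets of `e + D` in `{|e| < r₀}` ⟹ `e + D` has
  constants `(K + A, r₀ - a₀, g₀ - a₁, wmin(1-ρ)² - Kρ(2+3ρ) - b)`; the size `A` of `‖D²D‖` enters ONLY `K + A`
  (lemma: `hessQuad_ge_of_near_tangent`, the degradation of a tangential Hessian bound on near-tangent vectors);
* `cumulative_bounds_of_increments`: per-scale steps with weight `0 ≤ w ≤ W` sum to `(16/15)A₀W|U|`,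
  `(4/3)A₁WU²`, `A₂WU²|h|` ((2.36) ⟹ (2.41a), the `|h|` in the second-order term only);
* `geomConstants_effLevel`: (I_h) + `GeomConstants (ε_0 - μ)` + smallness of the ZEROTH/FIRST order sizes ⟹
  `GeomConstants (ε_h - μ)` for every `h_β ≤ h ≤ 0`; window/frame forms: `KLProgrammeDispersionFlowWindow.lean`.

Everything PROVED; no definitions, no `sorry`, standard axioms.  References: BGM06 Lemma 2.1, (2.36), (2.41a)
[BenfattoGiulianiMastropietro2006]; FST II §2 Lemma 2.1 [FeldmanSalmhoferTrubowitz1998]; HOME/P2-C4B.md §1 R-b, §4 S6(b), §5.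
-/

noncomputable section

-- the tree's namespace `Summit.<Summit>.<Problem>.Theorems` repeats the summit name by design (D-0017)
set_option linter.dupNamespace false

namespace Summit.HubbardSuperconductivity.HubbardSuperconductivity.Theorems.DispersionFlow

open Set Real
open scoped Topology InnerProductSpace
open Literature.MathematicalPhysics.QuantumLattice Literature.MathematicalPhysics.QuantumLattice.FermiRG

/-! ### The Hessian form: additivity, bilinear bound, near-tangent degradation -/

section Perturbation

variable {F : Type*} [NormedAddCommGroup F] [InnerProductSpace ℝ F]

/-- The Hessian form is additive in the function (both `C²` at the point). [folklore] -/
theorem hessQuad_add {e D : F → ℝ} {p : F} (he : ContDiffAt ℝ 2 e p) (hD : ContDiffAt ℝ 2 D p) (t : F) :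
    hessQuad (e + D) p t = hessQuad e p t + hessQuad D p t := by
  simp only [hessQuad, iteratedFDeriv_add_apply he hD]
  rfl

/-- The Hessian form through the second Fréchet derivative: `(v, f''(p) w)`-bilinearity is that of
`fderiv (fderiv f) p`. [folklore] -/
theorem hessQuad_eq_fderiv_fderiv (f : F → ℝ) (p v : F) :
    hessQuad f p v = fderiv ℝ (fderiv ℝ f) p v v := by
  rw [hessQuad, iteratedFDeriv_two_apply]
  rfl

/-- `|(x, f''(p) y)| ≤ ‖D²f(p)‖ |x| |y|`. [folklore] -/
theorem abs_fderiv_fderiv_le (f : F → ℝ) (p x y : F) :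
    |fderiv ℝ (fderiv ℝ f) p x y| ≤ ‖iteratedFDeriv ℝ 2 f p‖ * ‖x‖ * ‖y‖ := by
  rw [← norm_iteratedFDeriv_fderiv, norm_iteratedFDeriv_one, ← Real.norm_eq_abs]
  calc ‖fderiv ℝ (fderiv ℝ f) p x y‖ ≤ ‖fderiv ℝ (fderiv ℝ f) p x‖ * ‖y‖ := ContinuousLinearMap.le_opNorm _ _
    _ ≤ ‖fderiv ℝ (fderiv ℝ f) p‖ * ‖x‖ * ‖y‖ := by
        gcongr; exact ContinuousLinearMap.le_opNorm _ _

/-- **Slippage of the tangent space.**  If `(t₀, e''t₀) ≥ w|t₀|²` for `t₀ ⊥ u` (`u = ∇e(p) ≠ 0`) and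
`‖D²e(p)‖ ≤ K`, then for ANY `t` with `|⟪u, t⟫| ≤ ρ |u| |t|`, `0 ≤ ρ ≤ 1`:
`(t, e''t) ≥ (w(1-ρ)² - Kρ(2+3ρ)) |t|²` (decompose `t = t₀ + r`, `r` the component along `u`, `|r| ≤ ρ|t|`).
[folklore] -/
theorem hessQuad_ge_of_near_tangent {e : F → ℝ} {p u : F} {K w ρ : ℝ} (hu : u ≠ 0)
    (hK : ‖iteratedFDeriv ℝ 2 e p‖ ≤ K) (hw : ∀ t₀ : F, inner ℝ u t₀ = 0 → w * ‖t₀‖ ^ 2 ≤ hessQuad e p t₀)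
    (hw0 : 0 ≤ w) (hρ0 : 0 ≤ ρ) (hρ1 : ρ ≤ 1) {t : F} (ht : |inner ℝ u t| ≤ ρ * ‖u‖ * ‖t‖) :
    (w * (1 - ρ) ^ 2 - K * ρ * (2 + 3 * ρ)) * ‖t‖ ^ 2 ≤ hessQuad e p t := by
  have hu0 : 0 < ‖u‖ := norm_pos_iff.2 hu
  have hK0 : 0 ≤ K := (norm_nonneg _).trans hK
  -- the component of `t` along `u` and the tangential remainder
  set c : ℝ := inner ℝ u t / ‖u‖ ^ 2 with hc
  set r : F := c • u with hr
  set t₀ : F := t - r with ht₀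
  have ht_eq : t = t₀ + r := by rw [ht₀]; abel
  have hr_norm : ‖r‖ = |inner ℝ u t| / ‖u‖ := by
    rw [hr, norm_smul, Real.norm_eq_abs, hc, abs_div, abs_of_pos (pow_pos hu0 2)]
    field_simp
  have hr_le : ‖r‖ ≤ ρ * ‖t‖ := by
    rw [hr_norm, div_le_iff₀ hu0]
    calc |inner ℝ u t| ≤ ρ * ‖u‖ * ‖t‖ := ht
      _ = ρ * ‖t‖ * ‖u‖ := by ring
  have ht₀_perp : inner ℝ u t₀ = 0 := by
    rw [ht₀, inner_sub_right, hr, real_inner_smul_right, hc, real_inner_self_eq_norm_sq]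
    field_simp
    ring
  have ht₀_le : ‖t₀‖ ≤ (1 + ρ) * ‖t‖ := by
    calc ‖t₀‖ ≤ ‖t‖ + ‖r‖ := norm_sub_le t r
      _ ≤ ‖t‖ + ρ * ‖t‖ := by linarith
      _ = (1 + ρ) * ‖t‖ := by ring
  have ht₀_ge : (1 - ρ) * ‖t‖ ≤ ‖t₀‖ := by
    have : ‖t‖ ≤ ‖t₀‖ + ‖r‖ := by
      calc ‖t‖ = ‖t₀ + r‖ := by rw [← ht_eq]
        _ ≤ ‖t₀‖ + ‖r‖ := norm_add_le t₀ r
    nlinarith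
  have h1ρ : 0 ≤ 1 - ρ := by linarith
  have ht₀_sq : (1 - ρ) ^ 2 * ‖t‖ ^ 2 ≤ ‖t₀‖ ^ 2 := by
    rw [← mul_pow]
    exact pow_le_pow_left₀ (mul_nonneg h1ρ (norm_nonneg t)) ht₀_ge 2
  -- expand the quadratic form
  set B := fderiv ℝ (fderiv ℝ e) p with hB
  have hQ : hessQuad e p t = B t₀ t₀ + B t₀ r + B r t₀ + B r r := by
    rw [hessQuad_eq_fderiv_fderiv, ← hB, ht_eq, map_add]
    simp only [add_apply, map_add]
    ring
  have hQ0 : w * ‖t₀‖ ^ 2 ≤ B t₀ t₀ := by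
    have := hw t₀ ht₀_perp
    rwa [hessQuad_eq_fderiv_fderiv, ← hB] at this
  have hx1 : |B t₀ r| ≤ K * ‖t₀‖ * ‖r‖ :=
    (abs_fderiv_fderiv_le e p t₀ r).trans (by gcongr)
  have hx2 : |B r t₀| ≤ K * ‖r‖ * ‖t₀‖ :=
    (abs_fderiv_fderiv_le e p r t₀).trans (by gcongr)
  have hx3 : |B r r| ≤ K * ‖r‖ * ‖r‖ :=
    (abs_fderiv_fderiv_le e p r r).trans (by gcongr)
  have hx1' := neg_abs_le (B t₀ r)
  have hx2' := neg_abs_le (B r t₀)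
  have hx3' := neg_abs_le (B r r)
  have hrn : 0 ≤ ‖r‖ := norm_nonneg r
  have htn : 0 ≤ ‖t‖ := norm_nonneg t
  have ht₀n : 0 ≤ ‖t₀‖ := norm_nonneg t₀
  -- cross terms: `‖t₀‖‖r‖ ≤ (1+ρ)ρ‖t‖²`, `‖r‖² ≤ ρ²‖t‖²`
  have hc1 : ‖t₀‖ * ‖r‖ ≤ (1 + ρ) * ρ * ‖t‖ ^ 2 := by
    calc ‖t₀‖ * ‖r‖ ≤ ((1 + ρ) * ‖t‖) * (ρ * ‖t‖) := mul_le_mul ht₀_le hr_le hrn (by positivity)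
      _ = (1 + ρ) * ρ * ‖t‖ ^ 2 := by ring
  have hc2 : ‖r‖ * ‖r‖ ≤ ρ ^ 2 * ‖t‖ ^ 2 := by
    calc ‖r‖ * ‖r‖ ≤ (ρ * ‖t‖) * (ρ * ‖t‖) := mul_le_mul hr_le hr_le hrn (by positivity)
      _ = ρ ^ 2 * ‖t‖ ^ 2 := by ring
  rw [hQ]
  nlinarith [mul_le_mul_of_nonneg_left ht₀_sq hw0, mul_le_mul_of_nonneg_left hc1 hK0,
    mul_le_mul_of_nonneg_left hc2 hK0]

variable [CompleteSpace F]

/-- `‖∇f(x)‖ = ‖Df(x)‖` (Riesz). [folklore] -/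
theorem norm_gradient_eq_norm_fderiv (f : F → ℝ) (x : F) : ‖gradient f x‖ = ‖fderiv ℝ f x‖ := by
  rw [← toDual_gradient (𝕜 := ℝ), LinearIsometryEquiv.norm_map]

/-- **Persistence of the geometric constants** (the abstract core of BGM06 Lemma 2.1 (1)–(2) when the
second-order correction is bounded but not small).  Let `e` be `C²` with `GeomConstants e K r₀ g₀ wmin`, and let
`D` be `C²` with `|D| ≤ a₀ < r₀`, `‖DD‖ ≤ a₁`, `ρ := a₁/g₀ ≤ 1`, all derivatives of order `≤ 2` bounded by `A`,
and tangential Hessian `≥ -b|t|²` along the level sets of `e + D` inside `{|e| < r₀}`.  Then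
`GeomConstants (e + D) (K + A) (r₀ - a₀) (g₀ - a₁) (wmin(1-ρ)² - Kρ(2+3ρ) - b)`, provided the last constant is
positive.  The size `A` of `‖D²D‖` enters ONLY the derivative bound `K + A`. [folklore] -/
theorem GeomConstants.of_perturbation {e D : F → ℝ} {K r₀ g₀ wmin a₀ a₁ A b : ℝ}
    (hG : GeomConstants e K r₀ g₀ wmin) (he : ContDiff ℝ 2 e) (hD : ContDiff ℝ 2 D)
    (h0 : ∀ p, |D p| ≤ a₀) (h1 : ∀ p, ‖fderiv ℝ D p‖ ≤ a₁) (hA : ∀ p, ∀ j ≤ 2, ‖iteratedFDeriv ℝ j D p‖ ≤ A)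
    (hfloor : ∀ p, |e p| < r₀ → ∀ t : F, inner ℝ (gradient (e + D) p) t = 0 → -b * ‖t‖ ^ 2 ≤ hessQuad D p t)
    (ha₀ : a₀ < r₀) (ha₁ : 0 ≤ a₁) (hρ : a₁ < g₀)
    (hw : 0 < wmin * (1 - a₁ / g₀) ^ 2 - K * (a₁ / g₀) * (2 + 3 * (a₁ / g₀)) - b) :
    GeomConstants (e + D) (K + A) (r₀ - a₀) (g₀ - a₁)
      (wmin * (1 - a₁ / g₀) ^ 2 - K * (a₁ / g₀) * (2 + 3 * (a₁ / g₀)) - b) := by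
  have hg₀ := hG.g₀_pos
  have hρ0 : 0 ≤ a₁ / g₀ := div_nonneg ha₁ hg₀.le
  have hρ1 : a₁ / g₀ ≤ 1 := (div_le_one hg₀).2 hρ.le
  have he1 : Differentiable ℝ e := he.differentiable (by norm_num)
  have hD1 : Differentiable ℝ D := hD.differentiable (by norm_num)
  have hfd : ∀ p, fderiv ℝ (e + D) p = fderiv ℝ e p + fderiv ℝ D p := fun p => fderiv_add (he1 p) (hD1 p)
  have htube : ∀ p, |(e + D) p| < r₀ - a₀ → |e p| < r₀ := by
    intro p hp
    have hDp := h0 p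
    have hsplit : e p = (e + D) p - D p := by simp
    have : |e p| ≤ |(e + D) p| + |D p| := by rw [hsplit]; exact abs_sub _ _
    linarith
  refine ⟨by linarith, by linarith, hw, ?_, ?_, ?_⟩
  · -- all derivatives of order `≤ 2`
    intro p j hj
    have hej : ContDiffAt ℝ j e p := (he.of_le (by exact_mod_cast hj)).contDiffAt
    have hDj : ContDiffAt ℝ j D p := (hD.of_le (by exact_mod_cast hj)).contDiffAt
    rw [iteratedFDeriv_add_apply hej hDj]
    exact (norm_add_le _ _).trans (add_le_add (hG.norm_iteratedFDeriv_le p j hj) (hA p j hj))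
  · -- the gradient stays transversal
    intro p hp
    have hep := htube p hp
    have hgr := hG.le_norm_gradient p hep
    rw [norm_gradient_eq_norm_fderiv] at hgr ⊢
    rw [hfd p]
    have htri : ‖fderiv ℝ e p‖ ≤ ‖fderiv ℝ e p + fderiv ℝ D p‖ + ‖fderiv ℝ D p‖ := by
      have := norm_sub_le (fderiv ℝ e p + fderiv ℝ D p) (fderiv ℝ D p)
      rwa [add_sub_cancel_right] at this
    linarith [h1 p]
  · -- the tangential Hessian floor
    intro p hp t ht
    have hep := htube p hp
    rw [hessQuad_add he.contDiffAt hD.contDiffAt]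
    have hfl := hfloor p hep t ht
    have hgp : g₀ ≤ ‖gradient e p‖ := hG.le_norm_gradient p hep
    have hu : gradient e p ≠ 0 := by
      intro h0'
      rw [h0', norm_zero] at hgp
      linarith
    have hinner : |inner ℝ (gradient e p) t| ≤ a₁ / g₀ * ‖gradient e p‖ * ‖t‖ := by
      have h' : inner ℝ (gradient e p) t = -(fderiv ℝ D p t) := by
        have h0t := ht
        rw [inner_gradient_left, hfd p, add_apply] at h0t
        rw [inner_gradient_left]
        linarith
      rw [h', abs_neg]
      calc |fderiv ℝ D p t| ≤ ‖fderiv ℝ D p‖ * ‖t‖ := by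
            rw [← Real.norm_eq_abs]; exact ContinuousLinearMap.le_opNorm _ _
        _ ≤ a₁ * ‖t‖ := by gcongr; exact h1 p
        _ = a₁ / g₀ * g₀ * ‖t‖ := by field_simp
        _ ≤ a₁ / g₀ * ‖gradient e p‖ * ‖t‖ := by gcongr
    have hmain := hessQuad_ge_of_near_tangent hu (hG.norm_iteratedFDeriv_le p 2 le_rfl)
      (fun t₀ ht₀ => hG.le_hessQuad p hep t₀ ht₀) hG.wmin_pos.le hρ0 hρ1 hinner
    nlinarith [hfl, hmain, sq_nonneg ‖t‖]

/-- **Monotonicity of the constants**: larger `K`, smaller (positive) `r₀, g₀, wmin` remain valid. -/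
theorem GeomConstants.weaken {e : F → ℝ} {K r₀ g₀ wmin K' r₀' g₀' wmin' : ℝ} (hG : GeomConstants e K r₀ g₀ wmin)
    (hK : K ≤ K') (hr : r₀' ≤ r₀) (hg : g₀' ≤ g₀) (hw : wmin' ≤ wmin) (hr0 : 0 < r₀') (hg0 : 0 < g₀')
    (hw0 : 0 < wmin') : GeomConstants e K' r₀' g₀' wmin' where
  r₀_pos := hr0
  g₀_pos := hg0
  wmin_pos := hw0
  norm_iteratedFDeriv_le := fun p j hj => (hG.norm_iteratedFDeriv_le p j hj).trans hK
  le_norm_gradient := fun p hp => hg.trans (hG.le_norm_gradient p (hp.trans_le hr))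
  le_hessQuad := fun p hp t ht =>
    (mul_le_mul_of_nonneg_right hw (sq_nonneg _)).trans (hG.le_hessQuad p (hp.trans_le hr) t ht)

end Perturbation

/-! ### §5 Scale sums: per-scale increments with a bounded weight give cumulative bounds -/

/-- `γ^{2h} = 16⁻ⁿ` and `γ^h = 4⁻ⁿ` at `h = -n` (`γ = 4`). [folklore] -/
theorem zpow_four_neg_natCast (n : ℕ) :
    (4 : ℝ) ^ (2 * (-(n : ℤ))) = (16 : ℝ)⁻¹ ^ n ∧ (4 : ℝ) ^ (-(n : ℤ)) = (4 : ℝ)⁻¹ ^ n := by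
  refine ⟨?_, ?_⟩
  · rw [zpow_mul, zpow_neg, zpow_natCast, ← inv_pow]
    norm_num
  · rw [zpow_neg, zpow_natCast, inv_pow]

/-- **Cumulative bounds at `h = -n`, with the geometric remainders explicit** (induction on the number of
scales): `|ε_{-n} - ε_0| ≤ (16/15)A₀W|U|(1 - 16⁻ⁿ)`, `‖D(ε_{-n} - ε_0)‖ ≤ (4/3)A₁WU²(1 - 4⁻ⁿ)`,
`‖D²(ε_{-n} - ε_0)‖ ≤ A₂WU²·n`. [cite: BenfattoGiulianiMastropietro2006, §2.4 (2.41a)] -/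
theorem cumulative_bounds_aux {β U A₀ A₁ A₂ W : ℝ} {w : ℤ → ℝ} {hβ : ℤ}
    {E : ℤ → ℝ × (Fin 2 → ℝ) → ℂ} (hinc : EffectiveStepBounds β U A₀ A₁ A₂ w hβ E)
    (hw : ∀ j, hβ ≤ j → j ≤ 0 → 0 ≤ w j ∧ w j ≤ W) (hA₀ : 0 ≤ A₀) (hA₁ : 0 ≤ A₁) (hA₂ : 0 ≤ A₂) :
    ∀ n : ℕ, hβ ≤ -(n : ℤ) → ∀ p : Momentum,
      |effDisp β E (-(n : ℤ)) p - effDisp β E 0 p| ≤ 16 / 15 * A₀ * W * |U| * (1 - (16 : ℝ)⁻¹ ^ n) ∧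
      ‖iteratedFDeriv ℝ 1 (fun q => effDisp β E (-(n : ℤ)) q - effDisp β E 0 q) p‖ ≤
        4 / 3 * A₁ * W * U ^ 2 * (1 - (4 : ℝ)⁻¹ ^ n) ∧
      ‖iteratedFDeriv ℝ 2 (fun q => effDisp β E (-(n : ℤ)) q - effDisp β E 0 q) p‖ ≤
        A₂ * W * U ^ 2 * n := by
  intro n
  induction n with
  | zero =>
    intro _ p
    simp
  | succ n ih =>
    intro hn p
    have hn' : hβ ≤ -(n : ℤ) := by omega
    have hscale := (hinc.2 (-(n : ℤ)) hn' (by omega) p)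
    obtain ⟨ih0, ih1, ih2⟩ := ih hn' p
    obtain ⟨hw0, hwW⟩ := hw (-(n : ℤ)) hn' (by omega)
    have hW : 0 ≤ W := hw0.trans hwW
    obtain ⟨hz2, hz1⟩ := zpow_four_neg_natCast n
    -- the functions: `g_{h-1} = g_h - s_h`
    set g : Momentum → ℝ := fun q => effDisp β E (-(n : ℤ)) q - effDisp β E 0 q with hg
    set sfn : Momentum → ℝ := fun q => effDisp β E (-(n : ℤ)) q - effDisp β E (-(n : ℤ) - 1) q with hsfn
    have hcast : (-((n + 1 : ℕ) : ℤ)) = -(n : ℤ) - 1 := by push_cast; ring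
    have hfun : (fun q : Momentum => effDisp β E (-((n + 1 : ℕ) : ℤ)) q - effDisp β E 0 q) = g - sfn := by
      funext q
      simp only [hcast, hg, hsfn, Pi.sub_apply]
      ring
    have hgC : ContDiff ℝ 2 g := (hinc.1 _ (by omega)).sub (hinc.1 0 le_rfl)
    have hsC : ContDiff ℝ 2 sfn := (hinc.1 _ (by omega)).sub (hinc.1 _ (by omega))
    obtain ⟨hs0, hs1, hs2⟩ := hscale
    rw [hz2] at hs0
    rw [hz1] at hs1
    -- increments bounded with `w ≤ W`
    have hx16 : 0 ≤ ((16 : ℝ)⁻¹) ^ n := by positivity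
    have hx4 : 0 ≤ ((4 : ℝ)⁻¹) ^ n := by positivity
    have hs0' : |sfn p| ≤ A₀ * W * |U| * (16 : ℝ)⁻¹ ^ n := by
      calc |sfn p| ≤ A₀ * |U| * w (-(n : ℤ)) * (16 : ℝ)⁻¹ ^ n := hs0
        _ ≤ A₀ * |U| * W * (16 : ℝ)⁻¹ ^ n := by gcongr
        _ = A₀ * W * |U| * (16 : ℝ)⁻¹ ^ n := by ring
    have hs1' : ‖iteratedFDeriv ℝ 1 sfn p‖ ≤ A₁ * W * U ^ 2 * (4 : ℝ)⁻¹ ^ n := by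
      calc ‖iteratedFDeriv ℝ 1 sfn p‖ ≤ A₁ * U ^ 2 * w (-(n : ℤ)) * (4 : ℝ)⁻¹ ^ n := hs1
        _ ≤ A₁ * U ^ 2 * W * (4 : ℝ)⁻¹ ^ n := by gcongr
        _ = A₁ * W * U ^ 2 * (4 : ℝ)⁻¹ ^ n := by ring
    have hs2' : ‖iteratedFDeriv ℝ 2 sfn p‖ ≤ A₂ * W * U ^ 2 := by
      calc ‖iteratedFDeriv ℝ 2 sfn p‖ ≤ A₂ * U ^ 2 * w (-(n : ℤ)) := hs2
        _ ≤ A₂ * U ^ 2 * W := by gcongr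
        _ = A₂ * W * U ^ 2 := by ring
    rw [hfun]
    refine ⟨?_, ?_, ?_⟩
    · have hval : effDisp β E (-((n + 1 : ℕ) : ℤ)) p - effDisp β E 0 p = g p - sfn p := by
        simp only [hcast, hg, hsfn]
        ring
      rw [hval]
      calc |g p - sfn p| ≤ |g p| + |sfn p| := abs_sub _ _
        _ ≤ 16 / 15 * A₀ * W * |U| * (1 - (16 : ℝ)⁻¹ ^ n) + A₀ * W * |U| * (16 : ℝ)⁻¹ ^ n := by
            linarith
        _ = 16 / 15 * A₀ * W * |U| * (1 - (16 : ℝ)⁻¹ ^ (n + 1)) := by rw [pow_succ]; ring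
    · rw [iteratedFDeriv_sub_apply (hgC.of_le (by norm_num)).contDiffAt (hsC.of_le (by norm_num)).contDiffAt]
      calc ‖iteratedFDeriv ℝ 1 g p - iteratedFDeriv ℝ 1 sfn p‖
          ≤ ‖iteratedFDeriv ℝ 1 g p‖ + ‖iteratedFDeriv ℝ 1 sfn p‖ := norm_sub_le _ _
        _ ≤ 4 / 3 * A₁ * W * U ^ 2 * (1 - (4 : ℝ)⁻¹ ^ n) + A₁ * W * U ^ 2 * (4 : ℝ)⁻¹ ^ n := by linarith
        _ = 4 / 3 * A₁ * W * U ^ 2 * (1 - (4 : ℝ)⁻¹ ^ (n + 1)) := by rw [pow_succ]; ring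
    · rw [iteratedFDeriv_sub_apply hgC.contDiffAt hsC.contDiffAt]
      calc ‖iteratedFDeriv ℝ 2 g p - iteratedFDeriv ℝ 2 sfn p‖
          ≤ ‖iteratedFDeriv ℝ 2 g p‖ + ‖iteratedFDeriv ℝ 2 sfn p‖ := norm_sub_le _ _
        _ ≤ A₂ * W * U ^ 2 * n + A₂ * W * U ^ 2 := by linarith
        _ = A₂ * W * U ^ 2 * ((n + 1 : ℕ) : ℝ) := by push_cast; ring

/-- **Cumulative bounds from per-scale increments** (the general-weight form of (2.36) ⟹ (2.41a)): if
`EffectiveStepBounds β U A₀ A₁ A₂ w hβ E` with `0 ≤ w ≤ W` on the scales, then for every `h_β ≤ h ≤ 0` and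
every `p`: `|ε_h - ε_0| ≤ (16/15)A₀W|U|`, `‖D(ε_h - ε_0)‖ ≤ (4/3)A₁WU²`, and all derivatives of order `≤ 2` of
`ε_h - ε_0` are bounded by `max((16/15)A₀W|U|, (4/3)A₁WU², A₂WU²|h|)` — the `|h|` sits in the SECOND-ORDER term
only. [cite: BenfattoGiulianiMastropietro2006, §2.4 (2.41a)] -/
theorem cumulative_bounds_of_increments {β U A₀ A₁ A₂ W : ℝ} {w : ℤ → ℝ} {hβ : ℤ}
    {E : ℤ → ℝ × (Fin 2 → ℝ) → ℂ} (hinc : EffectiveStepBounds β U A₀ A₁ A₂ w hβ E)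
    (hw : ∀ j, hβ ≤ j → j ≤ 0 → 0 ≤ w j ∧ w j ≤ W) (hA₀ : 0 ≤ A₀) (hA₁ : 0 ≤ A₁) (hA₂ : 0 ≤ A₂)
    {h : ℤ} (hh₁ : hβ ≤ h) (hh₂ : h ≤ 0) (p : Momentum) :
    |effDisp β E h p - effDisp β E 0 p| ≤ 16 / 15 * A₀ * W * |U| ∧
    ‖fderiv ℝ (fun q => effDisp β E h q - effDisp β E 0 q) p‖ ≤ 4 / 3 * A₁ * W * U ^ 2 ∧
    (∀ j ≤ 2, ‖iteratedFDeriv ℝ j (fun q => effDisp β E h q - effDisp β E 0 q) p‖ ≤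
      max (16 / 15 * A₀ * W * |U|) (max (4 / 3 * A₁ * W * U ^ 2) (A₂ * W * U ^ 2 * |(h : ℝ)|))) := by
  obtain ⟨n, rfl⟩ : ∃ n : ℕ, h = -(n : ℤ) := ⟨(-h).toNat, by omega⟩
  obtain ⟨b0, b1, b2⟩ := cumulative_bounds_aux hinc hw hA₀ hA₁ hA₂ n hh₁ p
  obtain ⟨hw0, hwW⟩ := hw 0 (by omega) le_rfl
  have hW : 0 ≤ W := hw0.trans hwW
  have hx16 : 0 ≤ ((16 : ℝ)⁻¹) ^ n := by positivity
  have hx4 : 0 ≤ ((4 : ℝ)⁻¹) ^ n := by positivity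
  have hM₀ : 0 ≤ 16 / 15 * A₀ * W * |U| := by positivity
  have hM₁ : 0 ≤ 4 / 3 * A₁ * W * U ^ 2 := by positivity
  have c0 : |effDisp β E (-(n : ℤ)) p - effDisp β E 0 p| ≤ 16 / 15 * A₀ * W * |U| :=
    b0.trans (by nlinarith)
  have c1 : ‖iteratedFDeriv ℝ 1 (fun q => effDisp β E (-(n : ℤ)) q - effDisp β E 0 q) p‖ ≤
      4 / 3 * A₁ * W * U ^ 2 := b1.trans (by nlinarith)
  have habs : |((-(n : ℤ) : ℤ) : ℝ)| = n := by push_cast; rw [abs_neg]; exact abs_of_nonneg n.cast_nonneg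
  refine ⟨c0, ?_, ?_⟩
  · rw [← norm_iteratedFDeriv_one]; exact c1
  · intro j hj
    interval_cases j
    · rw [norm_iteratedFDeriv_zero, Real.norm_eq_abs]
      exact c0.trans (le_max_left _ _)
    · exact c1.trans ((le_max_left _ _).trans (le_max_right _ _))
    · rw [habs]
      exact b2.trans ((le_max_right _ _).trans (le_max_right _ _))

/-! ### The scale-`h` geometric constants from (I_h) -/

/-- **The scale-`h` Fermi curves keep FST II's geometric constants** (BGM06 Lemma 2.1 (1)–(2), abstract form with
explicit constants, valid as long as the ZEROTH and FIRST order cumulative corrections are small — whatever the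
size of the second-order one).  Assume the package with weight `0 ≤ w ≤ W` down to `h_β`, and
`GeomConstants (ε_0 - μ) K r₀ g₀ wmin` with `ē + (16/15)A₀W|U| ≤ r₀`... precisely: put
`a₀ = (16/15)A₀W|U|`, `a₁ = (4/3)A₁WU²`, `ρ = a₁/g₀`; if `a₀ < r₀`, `r₀ ≤ ē`, `a₁ ≤ g₀` and
`w' := wmin(1-ρ)² - Kρ(2+3ρ) - bU² > 0`, then for every `h_β ≤ h ≤ 0`:
`GeomConstants (ε_h - μ) (K + max(a₀, a₁, A₂WU²|h|)) (r₀ - a₀) (g₀ - a₁) w'`.  The lower constants do not see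
`|h|`; only the derivative bound does. [cite: BenfattoGiulianiMastropietro2006, §2.4 Lemma 2.1] -/
theorem geomConstants_effLevel {β U μ K r₀ g₀ wmin W : ℝ} {κ : KLFlowConstants} {w : ℤ → ℝ}
    {hβ : ℤ} {E : ℤ → ℝ × (Fin 2 → ℝ) → ℂ} (hyp : DispersionFlow β U μ κ w hβ E)
    (hw : ∀ j, hβ ≤ j → j ≤ 0 → 0 ≤ w j ∧ w j ≤ W) (hA₀ : 0 ≤ κ.A₀) (hA₁ : 0 ≤ κ.A₁) (hA₂ : 0 ≤ κ.A₂)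
    (hG : GeomConstants (effLevel β μ E 0) K r₀ g₀ wmin)
    (ha₀ : 16 / 15 * κ.A₀ * W * |U| < r₀) (hebar : r₀ ≤ κ.ebar) (ha₁ : 4 / 3 * κ.A₁ * W * U ^ 2 < g₀)
    (hw' : 0 < wmin * (1 - 4 / 3 * κ.A₁ * W * U ^ 2 / g₀) ^ 2 -
      K * (4 / 3 * κ.A₁ * W * U ^ 2 / g₀) * (2 + 3 * (4 / 3 * κ.A₁ * W * U ^ 2 / g₀)) - κ.b * U ^ 2)
    {h : ℤ} (hh₁ : hβ ≤ h) (hh₂ : h ≤ 0) :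
    GeomConstants (effLevel β μ E h)
      (K + max (16 / 15 * κ.A₀ * W * |U|) (max (4 / 3 * κ.A₁ * W * U ^ 2) (κ.A₂ * W * U ^ 2 * |(h : ℝ)|)))
      (r₀ - 16 / 15 * κ.A₀ * W * |U|) (g₀ - 4 / 3 * κ.A₁ * W * U ^ 2)
      (wmin * (1 - 4 / 3 * κ.A₁ * W * U ^ 2 / g₀) ^ 2 -
        K * (4 / 3 * κ.A₁ * W * U ^ 2 / g₀) * (2 + 3 * (4 / 3 * κ.A₁ * W * U ^ 2 / g₀)) - κ.b * U ^ 2) := by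
  obtain ⟨_, _, _, hinc, hfloor⟩ := hyp
  obtain ⟨hw0, hwW⟩ := hw 0 (hh₁.trans hh₂) le_rfl
  have hW : 0 ≤ W := hw0.trans hwW
  -- the perturbation `D = ε_h - ε_0` and the base `e = ε_0 - μ`
  set D : Momentum → ℝ := fun q => effDisp β E h q - effDisp β E 0 q with hDdef
  have heq : effLevel β μ E h = effLevel β μ E 0 + D := by
    funext q
    simp only [Pi.add_apply, effLevel_apply, hDdef]
    ring
  have he : ContDiff ℝ 2 (effLevel β μ E 0) := by
    have : effLevel β μ E 0 = fun q => effDisp β E 0 q - μ := rfl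
    rw [this]
    exact (hinc.1 0 le_rfl).sub contDiff_const
  have hD : ContDiff ℝ 2 D := (hinc.1 h hh₂).sub (hinc.1 0 le_rfl)
  have hcum := fun p => cumulative_bounds_of_increments hinc hw hA₀ hA₁ hA₂ hh₁ hh₂ p
  have hfl : ∀ p, |effLevel β μ E 0 p| < r₀ → ∀ t : Momentum,
      inner ℝ (gradient (effLevel β μ E 0 + D) p) t = 0 → -(κ.b * U ^ 2) * ‖t‖ ^ 2 ≤ hessQuad D p t := by
    intro p hp t ht
    rw [← heq] at ht
    exact hfloor h hh₁ hh₂ p (le_trans (le_of_lt hp) hebar) t ht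
  rw [heq]
  exact GeomConstants.of_perturbation hG he hD (fun p => (hcum p).1) (fun p => (hcum p).2.1)
    (fun p => (hcum p).2.2) hfl ha₀ (by positivity) ha₁ hw'

end Summit.HubbardSuperconductivity.HubbardSuperconductivity.Theorems.DispersionFlow

end
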